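import Summits.QuantumFields.YangMills.Theorems.BalabanUVNodesN22W1StripRunTowers
import Summits.QuantumFields.YangMills.Theorems.BalabanUVNodesN22KnitVertexCentered
import Summits.QuantumFields.YangMills.Theorems.BalabanUVNodesRateCarriersOfRecord13

/-!
# BalabanUVNodes ∕ node N22 = NE9 — THE W1 OBJECT ON THE RELATIVE-DISC CENTRED ROAD (RE-TYPING M1′), MODULE R0: THE JUNCTION — the CENTRED ORDER-TWO slot on the
# RELATIVE discs `closedBall (t : ℂ) (c·t)` for the level functional of a W1 reading + node N18 below ⟹ `N22At` at the reading's bundle, AT THE READING's OWN LETTERS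
# (`LetterInputs.analytic γ` with interpolation exponent `s = ½`, disc letter `r ≤ min(c, 1)`)

Cell `pub-ymgap`, HUMAN RULING D-0062 (Track A), R134 ACCELERATION re-seat `pub-ymgap-dag-n22-c` (strategy s1), generation 6, file R0 of the re-typed line.  THEOREMS ONLY; imports
module 15′ `…N22W1StripRunTowers` (modules 9 ∕ 13: `oscFading_w1Reading_of_n18At_below`, `pairingCoherence_ofRecordAdm`; node00-def-W1's `ReadingData`, `ReadingData.ofRecordAdm`,
`runTowers`, `termlessBeyond_runTowers`), seat n22-a's `…N22KnitVertexCentered` (M13c `ne9_and_fadingMemory_of_osc_analyticRelPowCentered` — (P) + (O) + the centred power-weighted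
RELATIVE-disc slot at order `p ≥ 2` ⟹ `NE9 ∧ FadingMemory` at the rate `θ^{1−1∕p}μ^{1∕p}`) and n22-e's `…RateCarriersOfRecord13` (`u3OfRecord₁₃ = u3OfRecord₁₂ ∘ toStage12Params`) BY NAME.
`--supports` K3⁗ `SpineGivenEndpointR13Sep` (stmt-QuantumFields-20292) as a helper.

WHY (this seat's g6 LOCATED + RE-TYPING, bus 2026-08-27 ≈06:30Z; rider `…N22W1StripLastTermwiseVertexRider`).  The uniform-disc last-coupling clause of this lineage's leaves
(22′ :134, 24′, 25′; 18′ ∕ 21′; 14′ §3–§4) is the type of the `γ_k`-VARIANT cut-off ([I] p. 266) — analyticity at zero coupling — and is met by the term of record under the χ of record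
(possibility 1, thresholds `ε₁∕g_k`) only coupling-blind.  With honest RELATIVE discs and (1.18)-type bounds alone the window-uniform g-form `N22At` does NOT follow (tree no-go
`T4CouplingAnalyticity.exists_couplingAnalyticRel_not_ne9Window`; relative analyticity yields the log-form `ne9Log_of_couplingAnalyticRel` only, which `U3Letters₁₁.Signs.ω_lt_one` and
`Spine.NE4.Targets.u2Inputs_of_u3` cannot take).  What DOES reach `N22At` under possibility 1 is a VERTEX letter: seat n22-a's CENTRED relative-disc road at ORDER TWO — every
young-coupling section `t ↦ E^{(j)}(X; g|g_i := t)` extends to `F` holomorphic on a set containing the relative discs `closedBall (t : ℂ) (c·t)`, `t ∈ ]0, γ]`, with a vertex value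
`e₀` and `‖F z − e₀‖ ≤ M·μ^{age}·t²·e^{−κd}` there (order two in `g` = order one in `s = g²`: the (2.14) terms are even in `(g, B) ↦ (−g, −B)`, lens T5) — which with node N18's
oscillation fading (O) gives `NE9 ∧ FadingMemory` at the rate `(θ₅μ)^{1∕2}` (M13c at `p = 2`).  THIS FILE is the JUNCTION of that road with the W1 reading of record: the rate
`(θ₅μ)^{1∕2}` and the constant `(256∕min(c,1))·C₀^{1∕2}(2M)^{1∕2}∕ω` ARE the reading's letter block `LetterInputs.analytic γ` at interpolation exponent `li.s = ½`, amplitude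
`li.A = M` and disc letter `li.r ≤ min(c, 1)` (then the record's `C₉` dominates M13c's and `NE9` is monotone in the moduli) — so the re-typed road lands in the SAME `U3Carriers`
bundle `u3OfRecord₁₂ θ (D.u3Objects θ.γ) k` the K3 skeleton keys, with no new letter block and no new reading.

WHAT.
* §1 `n22At_u3OfRecord₁₂_of_oscRelCentred` — THE CENTRED RELATIVE-DISC SLOT (A₂ᶜ) AT THE STAGE-12 BUNDLE `u3OfRecord₁₂ θ u k` (companion of n22-e's
  `…RateRecord12.n22At_u3OfRecord₁₂_of_oscAnalytic`): (P) + (O) at `C₀`, the bundle's `θ₅` + (A₂ᶜ) with letters `M, μ, c` + `u.ω = θ₅^{1∕2}μ^{1∕2}` + `C₉(M13c) ≤ u.C₉` ⟹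
  `N22At (u3OfRecord₁₂ θ u k)` (M13c at `p = 2` BY NAME, then monotonicity of `NE9` in the moduli and `N22Knit.fadingMemory_geometric`).
* §2 `n22At_u3OfRecord₁₂_w1Reading_of_oscRelCentred` — at node00-def-W1's generic reading `D : ReadingData F 𝔸 M` with `D.li.s = ½`, `D.li.r ≤ min(c,1)`, amplitude `D.li.A`,
  growth `D.li.μ`; `n22At_u3OfRecord₁₂_w1Reading_of_n18Below_relCentred` — its (O) DERIVED from `∀ k′ < k, N18At (u3OfRecord₁₂ θ (D.u3Objects θ.γ) k′)` along the pairings (module 9).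
* §3 ★ `n22At_u3OfRecord₁₂_ofRecordAdm_runTowers_of_n18Below_relCentred` — at the ADMISSIBLE READING OF RECORD ON THE TOWERS OF THE RUNS OF RECORD
  `ReadingData.ofRecordAdm F M N (runTowers S₀) sp gauge hg T₀ hT₀ li`: coherence by type (13), junk-freeness by `termlessBeyond_runTowers`; the slot stated on
  `Re E^{(j)}(X; g|g_i := t; (ιU, 0))` for the run tower `runTowers S₀ k`.
* §4 `n22At_u3OfRecord₁₃_ofRecordAdm_runTowers_of_n18Below_relCentred` — its Stage-13 twin (`u3OfRecord₁₃_eq_u3OfRecord₁₂`, `rfl`).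
THE PRODUCER of the slot (A₂ᶜ) from per-term schemas — (S-226-T) structural in the complex older terms on any domain, and the NEW per-term VERTEX schema (S-vertex-T) for the last
coupling on relative sectors — is this seat's next file (heredity by the strip induction 14′ §1 on relative sectors plus an interpolation tower); the K3⁗-currency tuple leaf at the
(2.14) datum follows it.

HONEST FRAMING.  Count-neutral by-name knit AT THE OBJECT; NOT a discharge of N22.  (A₂ᶜ) is DISPLAYED and asserted nowhere: for the LAST coupling it is [I] (2.13) p. 268 «the expression
under the exponential vanishes at `g_k = 0`» + p. 263 «C^∞-function of `g_{j−1} ∈ [0, γ]`, (or analytic)» made QUANTITATIVE at complex coupling on relative discs — NOT PRINTED as an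
estimate; for OLDER couplings it is NE9's unprinted core in the weakest analytic currency (relative discs, order one in `s = g²`).  (O) is node N18's (NE5, NOT PRINTED) read along the
pairings; the letter block is node00-def-W1's.  NE9 NOT IN PRINT for d = 4, NOT PROVED; one finite four-torus programme at fixed ε — NOT infinite volume, NOT OS on ℝ⁴, NOT a mass gap,
NOT Clay.  0 `sorry`, 0 `def`, standard axioms.

References (TYPES only): [I] = [Balaban1987RG1] (0.23)–(0.25) pp. 256–257, §1 p. 263, (2.9) p. 266, (2.13) p. 268; [II] = [Balaban1988RG2Cluster] (2.13)–(2.14) pp. 14–15,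
(2.40)–(2.41) p. 21.
-/

noncomputable section

open scoped Matrix.Norms.L2Operator

namespace YMDAG.N22.W1

open Set Metric
open scoped BigOperators
open Literature.MathematicalPhysics.QuantumFieldTheory.Balaban1983to89
open Literature.MathematicalPhysics.QuantumFieldTheory.Balaban1983to89.T4Continuum
open Literature.MathematicalPhysics.QuantumFieldTheory.Balaban1983to89.T4OutputRate
open Literature.MathematicalPhysics.QuantumFieldTheory.Balaban1983to89.TreeLengthTorus (TPt TDom tsys torusTreeLen torusTreeLen_nonneg)
open Literature.MathematicalPhysics.QuantumFieldTheory.Balaban1983to89.Node00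
  (Stage12Params Stage13Params U3Objects₁₁ U3Letters₁₁ MatA ιSU prependCoupling)
open Literature.MathematicalPhysics.QuantumFieldTheory.Balaban1983to89.Node00.Sect2 (domSys domCount CPair ofBackgroundC)
open Literature.MathematicalPhysics.QuantumFieldTheory.Balaban1983to89.Node00.W1
open Summit.QuantumFields.YangMills.BalabanUVNodes.N22Knit (fadingMemory_geometric)
open Summit.QuantumFields.YangMills.BalabanUVNodes.N22KnitVertexCentered (ne9_and_fadingMemory_of_osc_analyticRelPowCentered)
open YMDAG.UVSplit

variable {N : ℕ} [NeZero N]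

/-! ## §1 The centred relative-disc slot (A₂ᶜ) at the Stage-12 bundle `u3OfRecord₁₂ θ u k` -/

section Bundle

variable {F : T4Family} (θ : Stage12Params F N) (u : U3Objects₁₁) (k : ℕ)

/-- **THE CENTRED RELATIVE-DISC SLOT (A₂ᶜ) AT THE STAGE-12 BUNDLE.**  (P) prefix dependence of `u.EA k` on `]0, θ.γ]`, (O) oscillation fading with constant `C₀ > 0` at the block's NE5
rate `u.θ₅ > 0`, (A₂ᶜ) for every window history, background, domain `X` and young coupling `i < scale X`: ONE function `Fz` complex-differentiable on a set containing the RELATIVE closed discs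
`closedBall (t : ℂ) (c·t)`, `t ∈ ]0, θ.γ]`, a vertex value `e₀`, the CENTRED order-two letter `‖Fz z − e₀‖ ≤ M·μ^{scale X − 1 − i}·t²·e^{−κ d(X)}` on those discs, and `Fz t =` the section
`u.EA k (g|g_i := t) U X` on `]0, θ.γ]`; signs `0 < M`, `u.θ₅ ≤ μ`, `0 < c`; and the bundle's letters DOMINATE the road's: `u.ω = u.θ₅^{1∕2}μ^{1∕2}` and
`(256∕min(c,1))·C₀^{1∕2}(2M)^{1∕2}∕(u.θ₅^{1∕2}μ^{1∕2}) ≤ u.C₉` ⟹ `N22At (u3OfRecord₁₂ θ u k)`.  Seat n22-a's M13c `ne9_and_fadingMemory_of_osc_analyticRelPowCentered` at `p = 2` BY NAME, then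
`NE9` is monotone in the history moduli and the bundle's moduli ARE `C₉·ω^{k−i}` (`rfl`). [cite: Balaban1987RG1, §1 p.263, (2.9) p.266 and (2.13) p.268; Balaban1988RG2Cluster, (2.13)-(2.14) pp.14-15] -/
theorem n22At_u3OfRecord₁₂_of_oscRelCentred {C₀ M μ c : ℝ}
    (hP : PrefixDependenceOn (u.EA k) (Window θ.γ))
    (hO : ∀ g ∈ Window θ.γ, ∀ g' ∈ Window θ.γ, ∀ (U : (u.levelCarriers k).BgA) (X : (u.levelCarriers k).Dom) (a : ℕ), a ≤ (u.levelCarriers k).scale X →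
      (∀ n, a ≤ n → g n = g' n) → |u.EA k g U X - u.EA k g' U X| ≤ C₀ * u.θ₅ ^ ((u.levelCarriers k).scale X - a) * Real.exp (-(u.κ * (u.levelCarriers k).d X)))
    (hA : ∀ g ∈ Window θ.γ, ∀ (U : (u.levelCarriers k).BgA) (X : (u.levelCarriers k).Dom) (i : ℕ), i < (u.levelCarriers k).scale X →
      ∃ (Fz : ℂ → ℂ) (Dset : Set ℂ) (e₀ : ℂ), DifferentiableOn ℂ Fz Dset ∧ (∀ t ∈ Ioc (0 : ℝ) θ.γ, closedBall (t : ℂ) (c * t) ⊆ Dset) ∧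
        (∀ t ∈ Ioc (0 : ℝ) θ.γ, ∀ z ∈ closedBall (t : ℂ) (c * t),
          ‖Fz z - e₀‖ ≤ M * μ ^ ((u.levelCarriers k).scale X - 1 - i) * t ^ 2 * Real.exp (-(u.κ * (u.levelCarriers k).d X))) ∧
        (∀ t ∈ Ioc (0 : ℝ) θ.γ, Fz t = (u.EA k (Function.update g i t) U X : ℂ)))
    (hC₀ : 0 < C₀) (hθ : 0 < u.θ₅) (hM : 0 < M) (hθμ : u.θ₅ ≤ μ) (hc : 0 < c)
    (hω : u.ω = u.θ₅ ^ (1 - (2 : ℝ)⁻¹) * μ ^ (2 : ℝ)⁻¹)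
    (hC₉ : 32 * 2 ^ 2 / (min c 1 / 2) * (C₀ ^ (1 - (2 : ℝ)⁻¹) * (2 * M) ^ (2 : ℝ)⁻¹) / (u.θ₅ ^ (1 - (2 : ℝ)⁻¹) * μ ^ (2 : ℝ)⁻¹) ≤ u.C₉) :
    N22At (u3OfRecord₁₂ θ u k) := by
  have h9 := (ne9_and_fadingMemory_of_osc_analyticRelPowCentered (E := u.EA k) (p := 2) hP hO hA hC₀ hθ hM hθμ hc le_rfl).1
  simp only [Nat.cast_ofNat] at h9
  have hμ : 0 < μ := hθ.trans_le hθμ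
  have hτ : 0 < u.θ₅ ^ (1 - (2 : ℝ)⁻¹) * μ ^ (2 : ℝ)⁻¹ := mul_pos (Real.rpow_pos_of_pos hθ _) (Real.rpow_pos_of_pos hμ _)
  have hω0 : 0 ≤ u.ω := by rw [hω]; exact hτ.le
  have hC₉' : 0 ≤ 32 * 2 ^ 2 / (min c 1 / 2) * (C₀ ^ (1 - (2 : ℝ)⁻¹) * (2 * M) ^ (2 : ℝ)⁻¹) / (u.θ₅ ^ (1 - (2 : ℝ)⁻¹) * μ ^ (2 : ℝ)⁻¹) := by
    have h1 : 0 ≤ C₀ ^ (1 - (2 : ℝ)⁻¹) := Real.rpow_nonneg hC₀.le _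
    have h2 : 0 ≤ (2 * M) ^ (2 : ℝ)⁻¹ := Real.rpow_nonneg (by linarith) _
    have h3 : 0 < min c 1 / 2 := by positivity
    positivity
  have hC₉0 : 0 ≤ u.C₉ := hC₉'.trans hC₉
  refine ⟨?_, fadingMemory_geometric hC₉0 hω0⟩
  intro g hg g' hg' U X
  refine (h9 g hg g' hg' U X).trans (mul_le_mul_of_nonneg_left (Finset.sum_le_sum fun i _ => ?_) (Real.exp_pos _).le)
  refine mul_le_mul_of_nonneg_right ?_ (abs_nonneg _)
  show _ ≤ u.C₉ * u.ω ^ ((u.levelCarriers k).scale X - i)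
  rw [hω]
  exact mul_le_mul_of_nonneg_right hC₉ (pow_nonneg hτ.le _)

end Bundle

/-! ## §2 At node00-def-W1's generic reading `D : ReadingData F 𝔸 M`, at its own letters (`s = ½`, `r ≤ min(c,1)`, amplitude `A`, growth `μ`) -/

section Reading

variable {F : T4Family} (θ : Stage12Params F N) {𝔸 : Type*} {M : ℕ} (D : ReadingData F 𝔸 M) (k : ℕ)

/-- The letter domination of §1 at the reading: with `li.s = ½`, `0 < li.r ≤ min(c, 1)`, `0 < θ.γ`, the reading's `C₉ = (32∕(s²·min(r∕2, γ∕2)))·C₀^{1−s}(2A)^{s}∕(θ₅^{1−s}μ^{s})`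
(`ReadingData.u3Objects_C₉`) dominates M13c's `(32·2²∕(min(c,1)∕2))·C₀^{1∕2}(2A)^{1∕2}∕(θ₅^{1∕2}μ^{1∕2})`. [cite: Balaban1987RG1, (1.20)-(1.22) p.264 (letters; bookkeeping)] -/
theorem c₉_relCentred_le_u3Objects_C₉ {c : ℝ} (hC₀ : 0 ≤ D.li.C₀) (hA : 0 ≤ D.li.A) (hθ : 0 < D.li.θ₅) (hμ : 0 < D.li.μ) (hr : 0 < D.li.r)
    (hrc : D.li.r ≤ min c 1) (hγ : 0 < θ.γ) (hs : D.li.s = (2 : ℝ)⁻¹) :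
    32 * 2 ^ 2 / (min c 1 / 2) * (D.li.C₀ ^ (1 - (2 : ℝ)⁻¹) * (2 * D.li.A) ^ (2 : ℝ)⁻¹) / ((D.u3Objects θ.γ).θ₅ ^ (1 - (2 : ℝ)⁻¹) * D.li.μ ^ (2 : ℝ)⁻¹)
      ≤ (D.u3Objects θ.γ).C₉ := by
  rw [D.u3Objects_C₉, hs]
  have hm : 0 < min (D.li.r / 2) (θ.γ / 2) := lt_min (by linarith) (by linarith)
  have hm' : min (D.li.r / 2) (θ.γ / 2) ≤ min c 1 / 2 := (min_le_left _ _).trans (by linarith)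
  have hc1 : 0 < min c 1 := lt_of_lt_of_le hr hrc
  have hPQ : 0 ≤ D.li.C₀ ^ (1 - (2 : ℝ)⁻¹) * (2 * D.li.A) ^ (2 : ℝ)⁻¹ / ((D.u3Objects θ.γ).θ₅ ^ (1 - (2 : ℝ)⁻¹) * D.li.μ ^ (2 : ℝ)⁻¹) :=
    div_nonneg (mul_nonneg (Real.rpow_nonneg hC₀ _) (Real.rpow_nonneg (by linarith) _))
      (mul_nonneg (Real.rpow_nonneg hθ.le _) (Real.rpow_nonneg hμ.le _))
  have hK : 32 * 2 ^ 2 / (min c 1 / 2) ≤ 32 / ((2 : ℝ)⁻¹ ^ 2 * min (D.li.r / 2) (θ.γ / 2)) := by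
    rw [div_le_div_iff₀ (by positivity) (by positivity)]
    nlinarith
  calc 32 * 2 ^ 2 / (min c 1 / 2) * (D.li.C₀ ^ (1 - (2 : ℝ)⁻¹) * (2 * D.li.A) ^ (2 : ℝ)⁻¹) / ((D.u3Objects θ.γ).θ₅ ^ (1 - (2 : ℝ)⁻¹) * D.li.μ ^ (2 : ℝ)⁻¹)
      = 32 * 2 ^ 2 / (min c 1 / 2) * (D.li.C₀ ^ (1 - (2 : ℝ)⁻¹) * (2 * D.li.A) ^ (2 : ℝ)⁻¹ / ((D.u3Objects θ.γ).θ₅ ^ (1 - (2 : ℝ)⁻¹) * D.li.μ ^ (2 : ℝ)⁻¹)) := by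
        ring
    _ ≤ 32 / ((2 : ℝ)⁻¹ ^ 2 * min (D.li.r / 2) (θ.γ / 2)) *
          (D.li.C₀ ^ (1 - (2 : ℝ)⁻¹) * (2 * D.li.A) ^ (2 : ℝ)⁻¹ / ((D.u3Objects θ.γ).θ₅ ^ (1 - (2 : ℝ)⁻¹) * D.li.μ ^ (2 : ℝ)⁻¹)) :=
        mul_le_mul_of_nonneg_right hK hPQ
    _ = 32 / ((2 : ℝ)⁻¹ ^ 2 * min (D.li.r / 2) (θ.γ / 2)) * (D.li.C₀ ^ (1 - (2 : ℝ)⁻¹) * (2 * D.li.A) ^ (2 : ℝ)⁻¹) /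
          ((D.u3Objects θ.γ).θ₅ ^ (1 - (2 : ℝ)⁻¹) * D.li.μ ^ (2 : ℝ)⁻¹) := by
        ring

open Classical in
/-- **`N22At` AT THE LEVEL-`k` BUNDLE OF THE NAMED W1 READING, FROM THE CENTRED RELATIVE-DISC SLOT + (O)** (companion of module 7 §2 `n22At_u3OfRecord₁₂_w1Reading_of_stripBound` on the
re-typed road).  For node00-def-W1's reading data `D` at window radius `θ.γ`, level `k`: (A₂ᶜ) for the level functional `(D.pairing k).EA (D.S k)` with the reading's amplitude `D.li.A`,
growth `D.li.μ` and decay `D.li.κ` on the relative discs of aperture `c` + (O) at rate `D.li.θ₅` with constant `D.li.C₀` + the input signs (`0 < C₀`, `0 < θ₅ ≤ μ`, `0 < A`,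
`0 < r ≤ min(c,1)`, `s = ½`, `0 < θ.γ`) ⟹ `N22At (u3OfRecord₁₂ θ (D.u3Objects θ.γ) k)`.  The letter equations are the reading's `u3Objects_ω` ∕ `u3Objects_C₉` (`rfl`); (P) is
`prefixDependenceOn_u3Objects_EA`. [cite: Balaban1987RG1, §1 p.263, (2.9) p.266 and (2.13) p.268; Balaban1988RG2Cluster, (2.13)-(2.14) pp.14-15] -/
theorem n22At_u3OfRecord₁₂_w1Reading_of_oscRelCentred {c : ℝ}
    (hO : ∀ g ∈ Window θ.γ, ∀ g' ∈ Window θ.γ, ∀ (U : (D.pairing k).BgA) (X : (D.pairing k).carriers.Dom) (a : ℕ), a ≤ (D.pairing k).carriers.scale X →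
      (∀ n, a ≤ n → g n = g' n) → |(D.pairing k).EA (D.S k) g U X - (D.pairing k).EA (D.S k) g' U X| ≤
        D.li.C₀ * D.li.θ₅ ^ ((D.pairing k).carriers.scale X - a) * Real.exp (-(D.li.κ * (D.pairing k).carriers.d X)))
    (hA : ∀ g ∈ Window θ.γ, ∀ (U : (D.pairing k).BgA) (X : (D.pairing k).carriers.Dom) (i : ℕ), i < (D.pairing k).carriers.scale X →
      ∃ (Fz : ℂ → ℂ) (Dset : Set ℂ) (e₀ : ℂ), DifferentiableOn ℂ Fz Dset ∧ (∀ t ∈ Ioc (0 : ℝ) θ.γ, closedBall (t : ℂ) (c * t) ⊆ Dset) ∧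
        (∀ t ∈ Ioc (0 : ℝ) θ.γ, ∀ z ∈ closedBall (t : ℂ) (c * t),
          ‖Fz z - e₀‖ ≤ D.li.A * D.li.μ ^ ((D.pairing k).carriers.scale X - 1 - i) * t ^ 2 * Real.exp (-(D.li.κ * (D.pairing k).carriers.d X))) ∧
        (∀ t ∈ Ioc (0 : ℝ) θ.γ, Fz t = ((D.pairing k).EA (D.S k) (Function.update g i t) U X : ℂ)))
    (hC₀ : 0 < D.li.C₀) (hθ : 0 < D.li.θ₅) (hA0 : 0 < D.li.A) (hθμ : D.li.θ₅ ≤ D.li.μ) (hc : 0 < c) (hr : 0 < D.li.r) (hrc : D.li.r ≤ min c 1)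
    (hγ : 0 < θ.γ) (hs : D.li.s = (2 : ℝ)⁻¹) :
    N22At (u3OfRecord₁₂ θ (D.u3Objects θ.γ) k) := by
  refine n22At_u3OfRecord₁₂_of_oscRelCentred θ (D.u3Objects θ.γ) k (D.prefixDependenceOn_u3Objects_EA θ.γ k (Window θ.γ)) hO hA hC₀ hθ hA0 hθμ hc ?_
    (c₉_relCentred_le_u3Objects_C₉ θ D (c := c) hC₀.le hA0.le hθ (hθ.trans_le hθμ) hr hrc hγ hs)
  rw [D.u3Objects_ω, hs]

open Classical in
/-- **… WITH (O) DERIVED FROM NODE N18 AT THE RUN LENGTHS BELOW `k`** (module 9 `oscFading_w1Reading_of_n18At_below` along the pairings): (A₂ᶜ) + `∀ k′ < k,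
N18At (u3OfRecord₁₂ θ (D.u3Objects θ.γ) k′)` + the pairing coherence (C1)(C2) + the junk-freeness pin (J) + the input signs (`0 ≤ C₅`, `2C₅∕(1−θ₅) ≤ C₀`, `0 < C₀`, `0 < θ₅ < 1`,
`θ₅ ≤ μ`, `0 < A`, `0 < r ≤ min(c,1)`, `s = ½`, `0 < θ.γ`) ⟹ `N22At (u3OfRecord₁₂ θ (D.u3Objects θ.γ) k)`. [cite: Balaban1987RG1, (0.23)-(0.25) pp.256-257, §1 p.263 and (2.13) p.268; Balaban1988RG2Cluster, (2.13)-(2.14) pp.14-15] -/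
theorem n22At_u3OfRecord₁₂_w1Reading_of_n18Below_relCentred {c : ℝ}
    (hA : ∀ g ∈ Window θ.γ, ∀ (U : (D.pairing k).BgA) (X : (D.pairing k).carriers.Dom) (i : ℕ), i < (D.pairing k).carriers.scale X →
      ∃ (Fz : ℂ → ℂ) (Dset : Set ℂ) (e₀ : ℂ), DifferentiableOn ℂ Fz Dset ∧ (∀ t ∈ Ioc (0 : ℝ) θ.γ, closedBall (t : ℂ) (c * t) ⊆ Dset) ∧
        (∀ t ∈ Ioc (0 : ℝ) θ.γ, ∀ z ∈ closedBall (t : ℂ) (c * t),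
          ‖Fz z - e₀‖ ≤ D.li.A * D.li.μ ^ ((D.pairing k).carriers.scale X - 1 - i) * t ^ 2 * Real.exp (-(D.li.κ * (D.pairing k).carriers.d X))) ∧
        (∀ t ∈ Ioc (0 : ℝ) θ.γ, Fz t = ((D.pairing k).EA (D.S k) (Function.update g i t) U X : ℂ)))
    (hfst : ∀ (k : ℕ) (X₁ : Node00.W1.Dom (F.P k) M), ((D.pairing k).pair X₁).1 = X₁.1 + 1)
    (hdj : ∀ (k : ℕ) (X₁ : Node00.W1.Dom (F.P k) M),
      (domSys (F.P (k + 1)) M ((D.pairing k).pair X₁).1).dj ((D.pairing k).pair X₁).2 = (domSys (F.P k) M X₁.1).dj X₁.2)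
    (hsurj : ∀ (k : ℕ) (X : Node00.W1.Dom (F.P (k + 1)) M), 1 ≤ X.1 → ∃ X₁ : Node00.W1.Dom (F.P k) M, (D.pairing k).pair X₁ = X)
    (hbg : ∀ (k : ℕ) (U : (D.pairing (k + 1)).BgA), ∃ U₁ : (D.pairing k).BgB, (D.pairing k).embB U₁ = (D.pairing (k + 1)).embA U)
    (hjunk : ∀ (k : ℕ) (g : ℕ → ℝ) (U : (D.pairing k).BgA) (X : Node00.W1.Dom (F.P k) M), k < X.1 → (D.pairing k).EA (D.S k) g U X = 0)
    (h18 : ∀ k' : ℕ, k' < k → N18At (u3OfRecord₁₂ θ (D.u3Objects θ.γ) k'))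
    (hC5 : 0 ≤ D.li.C₅) (hθ1 : D.li.θ₅ < 1) (hC₀' : 2 * D.li.C₅ / (1 - D.li.θ₅) ≤ D.li.C₀)
    (hC₀ : 0 < D.li.C₀) (hθ : 0 < D.li.θ₅) (hA0 : 0 < D.li.A) (hθμ : D.li.θ₅ ≤ D.li.μ) (hc : 0 < c) (hr : 0 < D.li.r) (hrc : D.li.r ≤ min c 1)
    (hγ : 0 < θ.γ) (hs : D.li.s = (2 : ℝ)⁻¹) :
    N22At (u3OfRecord₁₂ θ (D.u3Objects θ.γ) k) :=
  n22At_u3OfRecord₁₂_w1Reading_of_oscRelCentred θ D k (oscFading_w1Reading_of_n18At_below θ D k hfst hdj hsurj hbg hjunk hC5 hθ.le hθ1 hC₀' h18) hA hC₀ hθ hA0 hθμ hc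
    hr hrc hγ hs

end Reading

/-! ## §3 At the admissible reading of record ON THE TOWERS OF THE RUNS OF RECORD — coherence and junk-freeness discharged -/

section RunTowers

variable {F : T4Family} {M : ℕ} (S₀ : (k : ℕ) → ClusterTower (F.P k) (MatA N) M)
  (sp : (k j : ℕ) → (domSys (F.P k) M j).Dom → Set (CPair (F.P k) (MatA N)))
  (gauge : (k : ℕ) → GaugeField (F.P k) 0 (Node00.SU N) → GaugeField (F.P k) 0 (Node00.SU N) → ℝ) (hg : ∀ k U U', 0 ≤ gauge k U U')
  (T₀ : (k : ℕ) → GaugeField (F.P (k + 1)) 0 (Node00.SU N) → GaugeField (F.P k) 0 (Node00.SU N))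
  (hT₀ : ∀ (k : ℕ) (U : GaugeField (F.P (k + 1)) 0 (Node00.SU N)),
    (∀ (j : ℕ) (Y : (domSys (F.P (k + 1)) M j).Dom), ofBackgroundC (ιSU N) U ∈ sp (k + 1) j Y) →
    ∀ (j : ℕ) (Y : (domSys (F.P k) M j).Dom), ofBackgroundC (ιSU N) (T₀ k U) ∈ sp k j Y)
  (li : LetterInputs) (θ : Stage12Params F N) (k : ℕ)

open Classical in
/-- **`N22At` AT THE LEVEL-`k` BUNDLE OF THE ADMISSIBLE READING OF RECORD ON THE TOWERS OF THE RUNS OF RECORD, FROM THE CENTRED RELATIVE-DISC SLOT + NODE N18 BELOW `k`**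
(`Dr := ReadingData.ofRecordAdm F M N (runTowers S₀) sp gauge hg T₀ hT₀ li`).  The pairing coherence is GONE (module 13, by type), the junk-freeness pin is GONE
(`termlessBeyond_runTowers`); what is displayed: (A₂ᶜ) for the sections `t ↦ Re E^{(j)}(X; g|g_i := t; (ιU, 0))` of the run tower `runTowers S₀ k` at every admissible background
`U : AdmBg F M N sp k` — ONE function holomorphic on a set containing the relative discs `closedBall (t : ℂ) (c·t)`, `t ∈ ]0, θ.γ]`, a vertex value, and the CENTRED order-two letter
`li.A·li.μ^{j−1−i}·t²·e^{−li.κ d_j(X)}` —, node N18 below `k` at the same reading, and the input signs (`s = ½`, `r ≤ min(c,1)`) ⟹ `N22At (u3OfRecord₁₂ θ (Dr.u3Objects θ.γ) k)`.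
[cite: Balaban1987RG1, (0.23)-(0.25) pp.256-257, §1 p.263, (2.9) p.266 and (2.13) p.268; Balaban1988RG2Cluster, (2.13)-(2.14) pp.14-15 and (2.40)-(2.41) p.21] -/
theorem n22At_u3OfRecord₁₂_ofRecordAdm_runTowers_of_n18Below_relCentred {c : ℝ}
    (hA : ∀ g ∈ Window θ.γ, ∀ (U : AdmBg F M N sp k) (X : Node00.W1.Dom (F.P k) M) (i : ℕ), i < X.1 →
      ∃ (Fz : ℂ → ℂ) (Dset : Set ℂ) (e₀ : ℂ), DifferentiableOn ℂ Fz Dset ∧ (∀ t ∈ Ioc (0 : ℝ) θ.γ, closedBall (t : ℂ) (c * t) ⊆ Dset) ∧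
        (∀ t ∈ Ioc (0 : ℝ) θ.γ, ∀ z ∈ closedBall (t : ℂ) (c * t),
          ‖Fz z - e₀‖ ≤ li.A * li.μ ^ (X.1 - 1 - i) * t ^ 2 * Real.exp (-(li.κ * (domSys (F.P k) M X.1).dj X.2))) ∧
        (∀ t ∈ Ioc (0 : ℝ) θ.γ, Fz t = ((functionalC (runTowers S₀ k) (Function.update g i t) (ofBackgroundC (ιSU N) U.1) X).re : ℂ)))
    (h18 : ∀ k' : ℕ, k' < k → N18At (u3OfRecord₁₂ θ ((ReadingData.ofRecordAdm F M N (runTowers S₀) sp gauge hg T₀ hT₀ li).u3Objects θ.γ) k'))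
    (hC5 : 0 ≤ li.C₅) (hθ1 : li.θ₅ < 1) (hC₀' : 2 * li.C₅ / (1 - li.θ₅) ≤ li.C₀)
    (hC₀ : 0 < li.C₀) (hθ : 0 < li.θ₅) (hA0 : 0 < li.A) (hθμ : li.θ₅ ≤ li.μ) (hc : 0 < c) (hr : 0 < li.r) (hrc : li.r ≤ min c 1)
    (hγ : 0 < θ.γ) (hs : li.s = (2 : ℝ)⁻¹) :
    N22At (u3OfRecord₁₂ θ ((ReadingData.ofRecordAdm F M N (runTowers S₀) sp gauge hg T₀ hT₀ li).u3Objects θ.γ) k) := by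
  obtain ⟨hfst, hdj, hsurj, hbg⟩ := pairingCoherence_ofRecordAdm (N := N) (runTowers S₀) sp gauge hg T₀ hT₀ li
  refine n22At_u3OfRecord₁₂_w1Reading_of_n18Below_relCentred θ (ReadingData.ofRecordAdm F M N (runTowers S₀) sp gauge hg T₀ hT₀ li) k
    (fun g hg' U X i hi => hA g hg' U X i hi) hfst hdj hsurj hbg (fun k₁ h U₁ X₁ hk₁ => ?_) h18 hC5 hθ1 hC₀' hC₀ hθ hA0 hθμ hc hr hrc hγ hs
  show (functionalC (runTowers S₀ k₁) h (ofBackgroundC (ιSU N) U₁.1) X₁).re = 0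
  rw [(termlessBeyond_runTowers S₀ k₁).functionalC_eq_zero h _ X₁ hk₁, Complex.zero_re]

end RunTowers

/-! ## §4 The same at one Stage-13 tuple -/

section RunTowers13

variable {F : T4Family} (θ : Stage13Params F N) (S₀ : (k : ℕ) → ClusterTower (F.P k) (MatA N) θ.τ9.M)
  (sp : (k j : ℕ) → (domSys (F.P k) θ.τ9.M j).Dom → Set (CPair (F.P k) (MatA N)))
  (gauge : (k : ℕ) → GaugeField (F.P k) 0 (Node00.SU N) → GaugeField (F.P k) 0 (Node00.SU N) → ℝ) (hg : ∀ k U U', 0 ≤ gauge k U U')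
  (T₀ : (k : ℕ) → GaugeField (F.P (k + 1)) 0 (Node00.SU N) → GaugeField (F.P k) 0 (Node00.SU N))
  (hT₀ : ∀ (k : ℕ) (U : GaugeField (F.P (k + 1)) 0 (Node00.SU N)),
    (∀ (j : ℕ) (Y : (domSys (F.P (k + 1)) θ.τ9.M j).Dom), ofBackgroundC (ιSU N) U ∈ sp (k + 1) j Y) →
    ∀ (j : ℕ) (Y : (domSys (F.P k) θ.τ9.M j).Dom), ofBackgroundC (ιSU N) (T₀ k U) ∈ sp k j Y)
  (li : LetterInputs) (k : ℕ)

open Classical in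
/-- **§3 AT ONE STAGE-13 TUPLE** (the Stage-13 bundle IS the Stage-12 bundle of `θ.toStage12Params`, n22-e's `u3OfRecord₁₃_eq_u3OfRecord₁₂`, `rfl`).
[cite: Balaban1987RG1, (0.23)-(0.25) pp.256-257, §1 p.263 and (2.13) p.268; Balaban1988RG2Cluster, (2.13)-(2.14) pp.14-15 and (2.40)-(2.41) p.21] -/
theorem n22At_u3OfRecord₁₃_ofRecordAdm_runTowers_of_n18Below_relCentred {c : ℝ}
    (hA : ∀ g ∈ Window θ.γ, ∀ (U : AdmBg F θ.τ9.M N sp k) (X : Node00.W1.Dom (F.P k) θ.τ9.M) (i : ℕ), i < X.1 →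
      ∃ (Fz : ℂ → ℂ) (Dset : Set ℂ) (e₀ : ℂ), DifferentiableOn ℂ Fz Dset ∧ (∀ t ∈ Ioc (0 : ℝ) θ.γ, closedBall (t : ℂ) (c * t) ⊆ Dset) ∧
        (∀ t ∈ Ioc (0 : ℝ) θ.γ, ∀ z ∈ closedBall (t : ℂ) (c * t),
          ‖Fz z - e₀‖ ≤ li.A * li.μ ^ (X.1 - 1 - i) * t ^ 2 * Real.exp (-(li.κ * (domSys (F.P k) θ.τ9.M X.1).dj X.2))) ∧
        (∀ t ∈ Ioc (0 : ℝ) θ.γ, Fz t = ((functionalC (runTowers S₀ k) (Function.update g i t) (ofBackgroundC (ιSU N) U.1) X).re : ℂ)))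
    (h18 : ∀ k' : ℕ, k' < k → N18At (u3OfRecord₁₃ θ ((ReadingData.ofRecordAdm F θ.τ9.M N (runTowers S₀) sp gauge hg T₀ hT₀ li).u3Objects θ.γ) k'))
    (hC5 : 0 ≤ li.C₅) (hθ1 : li.θ₅ < 1) (hC₀' : 2 * li.C₅ / (1 - li.θ₅) ≤ li.C₀)
    (hC₀ : 0 < li.C₀) (hθ5 : 0 < li.θ₅) (hA0 : 0 < li.A) (hθμ : li.θ₅ ≤ li.μ) (hc : 0 < c) (hr : 0 < li.r) (hrc : li.r ≤ min c 1)
    (hγ : 0 < θ.γ) (hs : li.s = (2 : ℝ)⁻¹) :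
    N22At (u3OfRecord₁₃ θ ((ReadingData.ofRecordAdm F θ.τ9.M N (runTowers S₀) sp gauge hg T₀ hT₀ li).u3Objects θ.γ) k) := by
  rw [u3OfRecord₁₃_eq_u3OfRecord₁₂]
  exact n22At_u3OfRecord₁₂_ofRecordAdm_runTowers_of_n18Below_relCentred S₀ sp gauge hg T₀ hT₀ li θ.toStage12Params k hA
    (fun k' hk => by rw [← u3OfRecord₁₃_eq_u3OfRecord₁₂]; exact h18 k' hk) hC5 hθ1 hC₀' hC₀ hθ5 hA0 hθμ hc hr hrc hγ hs

end RunTowers13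

end YMDAG.N22.W1

end
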